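import Summits.Schanuel.Schanuel.Theorems.ZilberEacResonantTranscendence
import Summits.Schanuel.Schanuel.Theorems.ZilberEacTranscendenceDensity
import Mathlib.Analysis.SpecialFunctions.Complex.LogDeriv
import Mathlib.Analysis.Complex.Polynomial.Basic
import HarnessLib

/-!
# The equimodular class, V: the resonant witness — at every exponential point of
# `{x₁ = c(x₀ - τ)² + κ, A(x₀) y₀ + B(x₀) = 0}` the coordinate `y₁` is an ANALYTIC function of
# `1/x₀`, transcendental over `ℂ(x₀)`

HONEST FRAMING.  Cell `pub-schanuel` (Zilber's Exponential-Algebraic Closedness, case ladder;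
host summit Schanuel), seat 2, gen 22.  The RESONANT DEGENERATE members of the equimodular class
over graph bases (gen 18 O67 / gen 21 O74, there called "Shapiro/Schanuel-type"): fibre
`A(x₀) y₀ + B(x₀) = 0` with `deg A = deg B ≥ 1`, `A, B` coprime, `lc B = -e^τ lc A`, base
`x₁ = c(x₀ - τ)² + κ`, `c ≠ 0` (resonant when `c ∈ -(i/2π)ℚ`, `τ' - τ ∈ iπℚ`; file VI).
**`exists_resonant_witness`**: there is `w` analytic at `0` and `R` such that (i) at every solution `z`
of `A(z)e^z + B(z) = 0` with `‖z‖ > R`, `exp(c(z - τ)² + κ) = exp(c(τ' - τ + 2πik)²) · w(1/z)` for some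
`k ∈ ℤ` EXACTLY — because `z - τ' - Λ(z) ∈ 2πiℤ` for `Λ(z) = log(-B(z)/(e^{τ'} A(z))) → 0`, with
`w(1/z) = exp(κ + 2c(z - τ)Λ(z) - cΛ(z)²)`; (ii) no nonzero `H ∈ ℂ[s][t]` has `H(1/u, w(u)) = 0` for
all small `u ≠ 0` (file III at a large generic point `z₀`, with `L = Λ`).  In the resonant case the
phase factor takes finitely many values (`= 1` when `c = -im/(2π)`, `τ' = τ`), so `|y₁|` stays bounded
along ALL exponential points: THEOREM G cannot decide these surfaces; THEOREM T (file IV) does.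
Nothing here bears on Schanuel's conjecture (neither used nor implied); Mantova–Masser's question is
OPEN.
-/

noncomputable section

open Filter Topology Polynomial Complex Bornology

set_option linter.dupNamespace false

namespace Summit.Schanuel.Schanuel.Theorems

/-! ## Part A. Reversed coefficient polynomials -/

/-- The reversed polynomial function `Ã(u) = Σ_{i ≤ N} a_i u^{N-i}` is analytic. [folklore] -/
theorem analyticAt_revSum (A : ℂ[X]) (N : ℕ) (u₀ : ℂ) :
    AnalyticAt ℂ (fun u : ℂ => ∑ i ∈ Finset.range (N + 1), A.coeff i * u ^ (N - i)) u₀ :=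
  Finset.analyticAt_fun_sum _ fun _ _ => analyticAt_const.mul (analyticAt_id.pow _)

/-- `Ã(0) = a_N`. [folklore] -/
theorem revSum_zero (A : ℂ[X]) (N : ℕ) :
    (∑ i ∈ Finset.range (N + 1), A.coeff i * (0 : ℂ) ^ (N - i)) = A.coeff N := by
  rw [Finset.sum_eq_single N]
  · simp
  · intro i hi hne
    have : N - i ≠ 0 := by
      have := Finset.mem_range.1 hi; omega
    rw [zero_pow this, mul_zero]
  · intro h; exact absurd (Finset.self_mem_range_succ N) h

/-! ## Part B. The witness -/

/-- **The resonant witness.**  See the module docstring: `w` analytic at `0`, the EXACT identity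
`exp(c(z - τ)² + κ) = exp(c(τ' - τ + 2πik)²)·w(1/z)` (some `k ∈ ℤ`) at every large solution of
`A(z)e^z + B(z) = 0` (`lc B = -e^{τ'} lc A`), and the transcendence of `w` over `ℂ(z)` at `0`. (new) -/
theorem exists_resonant_witness (A B : ℂ[X]) (hN : 1 ≤ A.natDegree) (hdeg : B.natDegree = A.natDegree)
    (hcop : IsCoprime A B) {c : ℂ} (hc0 : c ≠ 0) (τ τ' κ : ℂ)
    (hlc : B.leadingCoeff = -Complex.exp τ' * A.leadingCoeff) :
    ∃ (w : ℂ → ℂ) (R : ℝ), AnalyticAt ℂ w 0 ∧ (∀ u, w u ≠ 0) ∧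
      (∀ z : ℂ, R < ‖z‖ → A.eval z * Complex.exp z + B.eval z = 0 → ∃ k : ℤ,
        ‖z - τ' - k * (2 * Real.pi * I)‖ < 1 ∧
        Complex.exp ((Polynomial.C c * (Polynomial.X - Polynomial.C τ) ^ 2 + Polynomial.C κ).eval z) =
          Complex.exp (c * (τ' - τ + k * (2 * Real.pi * I)) ^ 2) * w z⁻¹) ∧
      (∀ H : ℂ[X][X], H ≠ 0 →
        ¬ (∀ᶠ u in 𝓝[≠] (0 : ℂ), (H.map (Polynomial.evalRingHom u⁻¹)).eval (w u) = 0)) := by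
  classical
  -- data
  set N := A.natDegree with hNdef
  set θ : ℂ := Complex.exp τ' with hθ
  have hθ0 : θ ≠ 0 := Complex.exp_ne_zero τ'
  have hA0 : A ≠ 0 := by
    intro h; rw [h, Polynomial.natDegree_zero] at hNdef; omega
  have hlcA : A.leadingCoeff ≠ 0 := Polynomial.leadingCoeff_ne_zero.2 hA0
  have hB0 : B ≠ 0 := by
    intro h
    rw [h, Polynomial.leadingCoeff_zero] at hlc
    exact (mul_ne_zero (neg_ne_zero.2 hθ0) hlcA) hlc.symm
  -- reversed polynomials and the germ data at `u = 0`
  set At : ℂ → ℂ := fun u => ∑ i ∈ Finset.range (N + 1), A.coeff i * u ^ (N - i) with hAt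
  set Bt : ℂ → ℂ := fun u => ∑ i ∈ Finset.range (N + 1), B.coeff i * u ^ (N - i) with hBt
  have hAt_an : ∀ u₀, AnalyticAt ℂ At u₀ := analyticAt_revSum A N
  have hBt_an : ∀ u₀, AnalyticAt ℂ Bt u₀ := analyticAt_revSum B N
  have hAt0 : At 0 = A.leadingCoeff := by rw [hAt]; exact revSum_zero A N
  have hBt0 : Bt 0 = B.leadingCoeff := by
    rw [hBt, Polynomial.leadingCoeff, hdeg]; exact revSum_zero B N
  have hAt_eq : ∀ u : ℂ, u ≠ 0 → u ^ N * A.eval u⁻¹ = At u := fun u hu =>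
    pow_mul_eval_inv_eq_sum A le_rfl hu
  have hBt_eq : ∀ u : ℂ, u ≠ 0 → u ^ N * B.eval u⁻¹ = Bt u := fun u hu =>
    pow_mul_eval_inv_eq_sum B (by rw [hdeg]) hu
  set r : ℂ → ℂ := fun u => -Bt u / (At u * θ) with hr
  have hr0 : r 0 = 1 := by
    rw [hr]; simp only [hAt0, hBt0, hlc, hθ]
    field_simp
  have hr_an : ∀ u₀, At u₀ ≠ 0 → AnalyticAt ℂ r u₀ := fun u₀ h =>
    (hBt_an u₀).neg.div ((hAt_an u₀).mul analyticAt_const) (mul_ne_zero h hθ0)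
  have hAt00 : At 0 ≠ 0 := by rw [hAt0]; exact hlcA
  -- `r(1/z) = -B(z)/(A(z) θ)` for `z ≠ 0`, `A(z) ≠ 0`
  have hr_eq : ∀ z : ℂ, z ≠ 0 → A.eval z ≠ 0 → r z⁻¹ = -B.eval z / (A.eval z * θ) := by
    intro z hz hAz
    have hu : z⁻¹ ≠ 0 := inv_ne_zero hz
    rw [hr]
    simp only
    rw [← hAt_eq _ hu, ← hBt_eq _ hu, inv_inv]
    have hzN : z⁻¹ ^ N ≠ 0 := pow_ne_zero _ hu
    field_simp
  set Λt : ℂ → ℂ := fun u => Complex.log (r u) with hΛt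
  have hΛt_an : AnalyticAt ℂ Λt 0 := (hr_an 0 hAt00).clog (by rw [hr0]; exact Complex.one_mem_slitPlane)
  have hΛt0 : Λt 0 = 0 := by rw [hΛt]; simp [hr0]
  set μ : ℂ → ℂ := dslope Λt 0 with hμ
  have hμ_an : AnalyticAt ℂ μ 0 := by
    obtain ⟨q, hq⟩ := hΛt_an
    exact ⟨_, hq.has_fpower_series_dslope_fslope⟩
  have hμ_eq : ∀ u : ℂ, u ≠ 0 → Λt u = u * μ u := by
    intro u hu
    rw [hμ, dslope_of_ne _ hu, slope_def_field, hΛt0, sub_zero, sub_zero]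
    field_simp
  set w : ℂ → ℂ := fun u => Complex.exp (κ + 2 * c * (1 - τ * u) * μ u - c * u ^ 2 * μ u ^ 2) with hw
  have hw_an : AnalyticAt ℂ w 0 :=
    (((analyticAt_const.add ((analyticAt_const.mul (analyticAt_const.sub
      (analyticAt_const.mul analyticAt_id))).mul hμ_an)).sub
      ((analyticAt_const.mul (analyticAt_id.pow 2)).mul (hμ_an.pow 2)))).cexp
  -- (K1) `w(1/z) = exp(κ + 2c(z - τ)Λ(1/z) - cΛ(1/z)²)`
  have hK1 : ∀ z : ℂ, z ≠ 0 →
      w z⁻¹ = Complex.exp (κ + 2 * c * (z - τ) * Λt z⁻¹ - c * Λt z⁻¹ ^ 2) := by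
    intro z hz
    rw [hw]
    simp only
    rw [hμ_eq _ (inv_ne_zero hz)]
    congr 1
    field_simp
  -- a radius beyond the roots of `A`
  obtain ⟨R₀, hR₀⟩ : ∃ R₀ : ℝ, ∀ z : ℂ, A.IsRoot z → ‖z‖ ≤ R₀ := by
    obtain ⟨C, hC⟩ := (A.roots.toFinset.finite_toSet.isBounded).exists_norm_le
    exact ⟨C, fun z hz => hC z (by simpa [Multiset.mem_toFinset, Polynomial.mem_roots hA0] using hz)⟩
  -- `Λ̃` is small near `0`
  obtain ⟨δ₂, hδ₂, hΛsmall⟩ : ∃ δ₂ > 0, ∀ u : ℂ, ‖u‖ < δ₂ → ‖Λt u‖ < 1 := by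
    have hc := hΛt_an.continuousAt
    rw [ContinuousAt, hΛt0, Metric.tendsto_nhds_nhds] at hc
    obtain ⟨δ₂, hδ₂, h⟩ := hc 1 one_pos
    exact ⟨δ₂, hδ₂, fun u hu => by simpa [dist_zero_right] using h (by simpa [dist_zero_right] using hu)⟩
  set R : ℝ := max (max R₀ 0) δ₂⁻¹ with hR
  have hAz : ∀ z : ℂ, R < ‖z‖ → A.eval z ≠ 0 := by
    intro z hz h
    have := hR₀ z h
    exact absurd (lt_of_le_of_lt ((le_max_left R₀ 0).trans (le_max_left _ _)) hz) (not_lt.2 this)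
  have hz0 : ∀ z : ℂ, R < ‖z‖ → z ≠ 0 := by
    intro z hz h
    rw [h, norm_zero] at hz
    exact absurd ((le_max_right R₀ 0).trans (le_max_left _ _)) (not_le.2 hz)
  have hΛz : ∀ z : ℂ, R < ‖z‖ → ‖Λt z⁻¹‖ < 1 := by
    intro z hz
    apply hΛsmall
    rw [norm_inv]
    have hzpos : 0 < ‖z‖ := lt_of_le_of_lt (by positivity) hz
    have h1 : δ₂⁻¹ < ‖z‖ := lt_of_le_of_lt (le_max_right _ _) hz
    calc ‖z‖⁻¹ < (δ₂⁻¹)⁻¹ := (inv_lt_inv₀ hzpos (by positivity)).2 h1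
      _ = δ₂ := inv_inv δ₂
  refine ⟨w, R, hw_an, fun u => Complex.exp_ne_zero _, ?_, ?_⟩
  · -- (K2) the exact identity at exponential points
    intro z hzR hPz
    have hz := hz0 z hzR
    have hA' := hAz z hzR
    have hexp : Complex.exp z = -B.eval z / A.eval z := by
      field_simp
      linear_combination hPz
    have hrz : r z⁻¹ ≠ 0 := by
      rw [hr_eq z hz hA']
      intro h
      rw [div_eq_zero_iff] at h
      rcases h with h | h
      · apply Complex.exp_ne_zero z
        rw [hexp, div_eq_zero_iff]
        exact Or.inl h
      · exact mul_ne_zero hA' hθ0 h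
    -- `exp(z - τ' - Λ) = 1`
    have hθr : θ * r z⁻¹ = Complex.exp z := by
      rw [hr_eq z hz hA', hexp]
      field_simp
    have h1 : Complex.exp (z - τ' - Λt z⁻¹) = 1 := by
      rw [Complex.exp_sub, Complex.exp_sub, hΛt]
      simp only
      rw [Complex.exp_log hrz, ← hθ, div_div, hθr, div_self (Complex.exp_ne_zero z)]
    obtain ⟨k, hk⟩ := Complex.exp_eq_one_iff.1 h1
    refine ⟨k, ?_, ?_⟩
    · have e : z - τ' - k * (2 * Real.pi * I) = Λt z⁻¹ := by linear_combination hk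
      rw [e]; exact hΛz z hzR
    rw [hK1 z hz]
    have hzτ : z - τ = (τ' - τ + k * (2 * Real.pi * I)) + Λt z⁻¹ := by linear_combination hk
    have key : (Polynomial.C c * (Polynomial.X - Polynomial.C τ) ^ 2 + Polynomial.C κ).eval z =
        c * (τ' - τ + k * (2 * Real.pi * I)) ^ 2 + (κ + 2 * c * (z - τ) * Λt z⁻¹ - c * Λt z⁻¹ ^ 2) := by
      simp only [Polynomial.eval_add, Polynomial.eval_mul, Polynomial.eval_C, Polynomial.eval_pow,
        Polynomial.eval_sub, Polynomial.eval_X]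
      rw [hzτ]; ring
    rw [key, Complex.exp_add]
  · -- (K3) transcendence of `w` at `0`
    intro H hH0 hH
    -- good `u`: the relation, `A~(u) ≠ 0`, `r u ∈ slitPlane`
    have hgoodA : ∀ᶠ u in 𝓝 (0 : ℂ), At u ≠ 0 := (hAt_an 0).continuousAt.eventually_ne hAt00
    have hgoodS : ∀ᶠ u in 𝓝 (0 : ℂ), r u ∈ Complex.slitPlane :=
      (hr_an 0 hAt00).continuousAt.eventually
        (Complex.isOpen_slitPlane.mem_nhds (by rw [hr0]; exact Complex.one_mem_slitPlane))
    have hall : ∀ᶠ u in 𝓝 (0 : ℂ), u ∈ ({0}ᶜ : Set ℂ) →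
        (H.map (Polynomial.evalRingHom u⁻¹)).eval (w u) = 0 ∧ At u ≠ 0 ∧ r u ∈ Complex.slitPlane := by
      have h' := eventually_nhdsWithin_iff.1 hH
      filter_upwards [h', hgoodA, hgoodS] with u hu ha hs
      exact fun hu0 => ⟨hu hu0, ha, hs⟩
    obtain ⟨δ, hδ, hball⟩ := Metric.eventually_nhds_iff.1 hall
    -- a large generic point `z₀`
    set Bad : ℂ[X] := A * B * (A * B - (A * derivative B - derivative A * B)) with hBad
    have hR1lt : (A * derivative B - derivative A * B).natDegree < (A * B).natDegree := by
      have h2N : (A * B).natDegree = N + N := by rw [Polynomial.natDegree_mul hA0 hB0, hdeg]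
      rw [h2N]
      refine lt_of_le_of_lt (Polynomial.natDegree_sub_le _ _) ?_
      have hdA : (derivative A).natDegree ≤ N - 1 := Polynomial.natDegree_derivative_le A
      have hdB : (derivative B).natDegree ≤ N - 1 := by
        have := Polynomial.natDegree_derivative_le B; rwa [hdeg] at this
      have h1 : (A * derivative B).natDegree ≤ N + (N - 1) :=
        (Polynomial.natDegree_mul_le).trans (add_le_add le_rfl hdB)
      have h2 : (derivative A * B).natDegree ≤ (N - 1) + N :=
        (Polynomial.natDegree_mul_le).trans (add_le_add hdA (by rw [hdeg]))
      rw [max_lt_iff]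
      constructor <;> omega
    have hBad0 : Bad ≠ 0 := by
      refine mul_ne_zero (mul_ne_zero hA0 hB0) (sub_ne_zero.2 ?_)
      intro h
      rw [h] at hR1lt
      exact lt_irrefl _ hR1lt
    set T : Set ℂ := ((fun x : ℝ => (x : ℂ)) '' Set.Ioi (max R 0 + 2 / δ)) with hT
    have hTinf : T.Infinite :=
      (Set.Ioi_infinite _).image (Complex.ofReal_injective.injOn)
    obtain ⟨z₀, hz₀T, hz₀bad⟩ := hTinf.exists_notMem_finset Bad.roots.toFinset
    obtain ⟨x₀, hx₀, rfl⟩ := hz₀T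
    have hx₀' : max R 0 + 2 / δ < x₀ := hx₀
    have hnorm₀ : ‖(x₀ : ℂ)‖ = x₀ := by
      rw [Complex.norm_real, Real.norm_eq_abs, abs_of_pos]
      have : (0 : ℝ) < 2 / δ := by positivity
      linarith [le_max_right R 0]
    have hBadz₀ : ¬ Bad.IsRoot (x₀ : ℂ) := by
      intro h
      exact hz₀bad (by rw [Multiset.mem_toFinset, Polynomial.mem_roots hBad0]; exact h)
    have hAB0 : (A * B).eval (x₀ : ℂ) ≠ 0 := by
      intro h; apply hBadz₀
      rw [Polynomial.IsRoot, hBad, Polynomial.eval_mul, h, zero_mul]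
    have hne1 : (A * derivative B - derivative A * B).eval (x₀ : ℂ) ≠ (A * B).eval (x₀ : ℂ) := by
      intro h; apply hBadz₀
      rw [Polynomial.IsRoot, hBad, Polynomial.eval_mul, Polynomial.eval_sub, h, sub_self, mul_zero]
    -- near `z₀`: `‖z‖ > max R 0 + 1/δ`, so `1/z` is a good `u`
    have hnear : ∀ᶠ z in 𝓝 (x₀ : ℂ), max R 0 + 1 / δ < ‖z‖ := by
      refine (continuous_norm.continuousAt (x := (x₀ : ℂ))).eventually (lt_mem_nhds ?_)
      change max R 0 + 1 / δ < ‖(x₀ : ℂ)‖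
      rw [hnorm₀]
      have : (0 : ℝ) < 1 / δ := by positivity
      have h2 : (2 : ℝ) / δ = 2 * (1 / δ) := by ring
      linarith
    have hgoodz : ∀ᶠ z in 𝓝 (x₀ : ℂ), z ≠ 0 ∧ A.eval z ≠ 0 ∧
        (H.map (Polynomial.evalRingHom z)).eval (w z⁻¹) = 0 ∧ At z⁻¹ ≠ 0 ∧
          r z⁻¹ ∈ Complex.slitPlane := by
      filter_upwards [hnear] with z hz
      change max R 0 + 1 / δ < ‖z‖ at hz
      have hzR : R < ‖z‖ := by
        have : (0 : ℝ) < 1 / δ := by positivity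
        linarith [le_max_left R 0]
      have hz0' : z ≠ 0 := hz0 z hzR
      have hzinv : dist z⁻¹ 0 < δ := by
        rw [dist_zero_right, norm_inv]
        have hzpos : 0 < ‖z‖ := norm_pos_iff.2 hz0'
        have h1 : 1 / δ < ‖z‖ := by linarith [le_max_right R 0]
        calc ‖z‖⁻¹ < (1 / δ)⁻¹ := by
              exact (inv_lt_inv₀ hzpos (by positivity)).2 h1
          _ = δ := by rw [one_div, inv_inv]
      obtain ⟨h1, h2, h3⟩ := hball hzinv (by simpa using hz0')
      rw [inv_inv] at h1
      exact ⟨hz0', hAz z hzR, h1, h2, h3⟩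
    -- the function `L = Λ` near `z₀` and its derivative
    set L : ℂ → ℂ := fun z => Λt z⁻¹ with hL
    obtain ⟨hz₀0, hAz₀, -, hAtz₀, hSz₀⟩ := hgoodz.self_of_nhds
    have hLan : AnalyticAt ℂ L (x₀ : ℂ) := by
      rw [hL, hΛt]
      exact ((hr_an _ hAtz₀).comp (analyticAt_inv hz₀0)).clog hSz₀
    have hLderiv : ∀ᶠ z in 𝓝 (x₀ : ℂ), HasDerivAt L
        ((A * derivative B - derivative A * B).eval z / (A * B).eval z) z := by
      have hgg := eventually_eventually_nhds.2 hgoodz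
      filter_upwards [hgoodz, hgg] with z hz hzz
      obtain ⟨hz0', hAz', -, -, hSz⟩ := hz
      -- `L = log(-B/(A θ))` near `z`
      have hLloc : L =ᶠ[𝓝 z] fun y => Complex.log (-B.eval y / (A.eval y * θ)) := by
        filter_upwards [hzz] with y hy
        rw [hL]
        simp only [hΛt]
        rw [hr_eq y hy.1 hy.2.1]
      have hf : HasDerivAt (fun y => -B.eval y / (A.eval y * θ))
          ((-(derivative B).eval z * (A.eval z * θ) - -B.eval z * ((derivative A).eval z * θ)) /
            (A.eval z * θ) ^ 2) z :=
        ((Polynomial.hasDerivAt B z).neg).div ((Polynomial.hasDerivAt A z).mul_const θ)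
          (mul_ne_zero hAz' hθ0)
      have hslit : -B.eval z / (A.eval z * θ) ∈ Complex.slitPlane := by
        rw [← hr_eq z hz0' hAz']; exact hSz
      have hlog := hf.clog hslit
      refine (hlog.congr_of_eventuallyEq hLloc).congr_deriv ?_
      have hBz : B.eval z ≠ 0 := by
        intro hB
        rw [hB, neg_zero, zero_div] at hslit
        exact Complex.slitPlane_ne_zero hslit rfl
      rw [Polynomial.eval_mul, Polynomial.eval_sub, Polynomial.eval_mul, Polynomial.eval_mul]
      field_simp
      ring
    -- a root of `A` that is not a root of `B`
    obtain ⟨a, ha⟩ : ∃ a, A.IsRoot a := Complex.exists_root (by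
      rw [Polynomial.degree_eq_natDegree hA0]; exact_mod_cast hN)
    have hBa : ¬ B.IsRoot a := by
      intro hb
      obtain ⟨u, v, huv⟩ := hcop
      have := congrArg (Polynomial.eval a) huv
      rw [Polynomial.eval_add, Polynomial.eval_mul, Polynomial.eval_mul, ha.eq_zero, hb.eq_zero,
        mul_zero, mul_zero, add_zero, Polynomial.eval_one] at this
      exact zero_ne_one this
    -- the relation near `z₀` in the form of file III
    have hHw : ∀ᶠ z in 𝓝 (x₀ : ℂ), (H.map (Polynomial.evalRingHom z)).eval
        (Complex.exp (κ + 2 * c * (z - τ) * L z - c * L z ^ 2)) = 0 := by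
      filter_upwards [hgoodz] with z hz
      obtain ⟨hz0', -, hHz, -, -⟩ := hz
      rw [hL]
      simp only
      rw [← hK1 z hz0']
      exact hHz
    exact not_algebraic_resonantExp hA0 hB0 (Or.inl ⟨ha, hBa⟩) hLan hLderiv hAB0 hne1 hc0 τ κ hH0 hHw

end Summit.Schanuel.Schanuel.Theorems
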